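import Summits.MatrixMultiplication.MatrixMultiplication.Theses.LevelGradedCohnUmans

/-!
# `SnLevelDesigns` (crux stmt-MatrixMultiplication-7613, route `LevelGradedCohnUmans`):
# sign orthogonality and the covering wall (negative-side support, refuter cdisprove seat)

Sorry-free; nothing here asserts a route item positively.  The separation hypothesis `h` of
each theorem is the crux's `k`-token separation clause verbatim (inlined).

* `sum_sign_mul_tokenSum` — for `k + 2 ≤ n` every `k`-token functional
  `g ↦ ∑_{p : [k]→[n]} c p (g ∘ p)` is orthogonal to the sign character (right-multiply the fibre
  `{g ∘ p = q}` by a transposition of two points outside `range p`).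
* `exists_not_mem_quot` — hence for a `k`-token separated triple with `k ≤ n - 2` the quotient set
  `Q = X⁻¹ Y Y⁻¹ Z` never covers `𝔖ₙ` (else the separator of a target is a delta function, which
  is not orthogonal to `sgn`).
* `quotXY_injOn`, `quotYZ_injOn`, `quotXZ_injOn` — the TPP shadow of separation.
* `card_add_card_le_factorial` — the COVERING WALL `|X||Y| + |Y||Z| ≤ n!` (`k ≤ n-2`, `X, Z ≠ ∅`).
* `four_mul_volume_sq_le` — with `|X||Z| ≤ n!`: `4 (|X||Y||Z|)² ≤ (n!)³`, i.e. graded designs at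
  any level `≤ n - 2` fill at most half of the square-root packing bound `(n!)^{3/2}`.
Companion files: `DeadCorners.lean`, `DimensionWalls.lean`; census in `Cruxes/SnLevelDesigns/Disproof.lean`.
-/

namespace Summit.MatrixMultiplication.MatrixMultiplication.Theorems.SnLevelDesigns.Negative

open scoped BigOperators

noncomputable section

/-- For `k + 2 ≤ n` every `k`-token functional is orthogonal to the sign character: the fibre
`{g : g ∘ p = q}` is stable under right multiplication by a transposition of two points outside
the range of `p`, which flips the sign. -/
theorem sum_sign_mul_tokenSum {n k : ℕ} (hk : k + 2 ≤ n)
    (c : (Fin k → Fin n) → (Fin k → Fin n) → ℂ) :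
    ∑ g : Equiv.Perm (Fin n), ((Equiv.Perm.sign g : ℤ) : ℂ) * ∑ p : Fin k → Fin n, c p (⇑g ∘ p) = 0 := by
  classical
  simp_rw [Finset.mul_sum]
  rw [Finset.sum_comm]
  refine Finset.sum_eq_zero fun p _ => ?_
  -- two points outside the range of `p`
  have hcard : 2 ≤ ((Finset.univ.image p)ᶜ).card := by
    rw [Finset.card_compl, Fintype.card_fin]
    have : (Finset.univ.image p).card ≤ k := by
      calc (Finset.univ.image p).card ≤ (Finset.univ : Finset (Fin k)).card := Finset.card_image_le
        _ = k := by simp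
    omega
  obtain ⟨a, ha, b, hb, hab⟩ := Finset.one_lt_card.mp hcard
  have hpa : ∀ i, p i ≠ a := fun i h => by
    have : a ∈ Finset.univ.image p := Finset.mem_image.mpr ⟨i, Finset.mem_univ _, h⟩
    exact (Finset.mem_compl.mp ha) this
  have hpb : ∀ i, p i ≠ b := fun i h => by
    have : b ∈ Finset.univ.image p := Finset.mem_image.mpr ⟨i, Finset.mem_univ _, h⟩
    exact (Finset.mem_compl.mp hb) this
  set τ : Equiv.Perm (Fin n) := Equiv.swap a b with hτ
  set F : Equiv.Perm (Fin n) → ℂ := fun g => ((Equiv.Perm.sign g : ℤ) : ℂ) * c p (⇑g ∘ p) with hF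
  have hreindex : ∑ g, F g = ∑ g, F (g * τ) :=
    (Fintype.sum_equiv (Equiv.mulRight τ) (fun g => F (g * τ)) F (fun g => rfl)).symm
  have hflip : ∀ g, F (g * τ) = - F g := by
    intro g
    have hcomp : (⇑(g * τ) ∘ p : Fin k → Fin n) = ⇑g ∘ p := by
      funext i
      simp [hτ, Equiv.swap_apply_of_ne_of_ne (hpa i) (hpb i)]
    have hsign : ((Equiv.Perm.sign (g * τ) : ℤ) : ℂ) = - ((Equiv.Perm.sign g : ℤ) : ℂ) := by
      rw [Equiv.Perm.sign_mul, hτ, Equiv.Perm.sign_swap hab]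
      push_cast
      ring
    simp only [hF, hcomp, hsign, neg_mul]
  have : ∑ g, F g = - ∑ g, F g := by
    conv_lhs => rw [hreindex]
    rw [← Finset.sum_neg_distrib]
    exact Finset.sum_congr rfl fun g _ => hflip g
  have h0 : ∑ g, F g = 0 := by
    have h2 : (2 : ℂ) * ∑ g, F g = 0 := by rw [two_mul]; nth_rewrite 1 [this]; ring
    exact (mul_eq_zero.mp h2).resolve_left two_ne_zero
  simpa [hF] using h0

/-- For a `k`-token separated triple with `k + 2 ≤ n`, the quotient set `X⁻¹YY⁻¹Z` misses some
permutation (otherwise the separator of the target `(x₀, z₀)` is the delta function at `x₀⁻¹z₀`,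
contradicting `sum_sign_mul_tokenSum`). -/
theorem exists_not_mem_quot {n k : ℕ} {X Y Z : Finset (Equiv.Perm (Fin n))} (h : ∀ x₀ ∈ X, ∀ z₀ ∈ Z, ∃ c : (Fin k → Fin n) → (Fin k → Fin n) → ℂ, ∀ x ∈ X, ∀ y ∈ Y,
      ∀ y' ∈ Y, ∀ z ∈ Z, (∑ p : Fin k → Fin n, c p (⇑(x⁻¹ * y * y'⁻¹ * z) ∘ p)) =
        if x = x₀ ∧ y = y' ∧ z = z₀ then 1 else 0)
    (hk : k + 2 ≤ n) {x₀ : Equiv.Perm (Fin n)} (hx₀ : x₀ ∈ X) {z₀ : Equiv.Perm (Fin n)}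
    (hz₀ : z₀ ∈ Z) :
    ∃ g : Equiv.Perm (Fin n), ∀ x ∈ X, ∀ y ∈ Y, ∀ y' ∈ Y, ∀ z ∈ Z, x⁻¹ * y * y'⁻¹ * z ≠ g := by
  classical
  by_contra hall
  push Not at hall
  obtain ⟨c, hc⟩ := h x₀ hx₀ z₀ hz₀
  have hf : ∀ g : Equiv.Perm (Fin n), (∑ p : Fin k → Fin n, c p (⇑g ∘ p)) =
      if g = x₀⁻¹ * z₀ then 1 else 0 := by
    intro g
    obtain ⟨x, hx, y, hy, y', hy', z, hz, hg⟩ := hall g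
    have hval := hc x hx y hy y' hy' z hz
    rw [hg] at hval
    rw [hval]
    by_cases hcond : x = x₀ ∧ y = y' ∧ z = z₀
    · obtain ⟨rfl, rfl, rfl⟩ := hcond
      rw [if_pos ⟨rfl, rfl, rfl⟩, if_pos]
      rw [← hg]; group
    · rw [if_neg hcond]
      by_cases hg0 : g = x₀⁻¹ * z₀
      · -- then the target quadruple `(x₀, y, y, z₀)` also produces `g`, value 1 ≠ 0: use it
        have hval' := hc x₀ hx₀ y hy y hy z₀ hz₀
        rw [if_pos ⟨rfl, rfl, rfl⟩] at hval'
        have : x₀⁻¹ * y * y⁻¹ * z₀ = g := by rw [hg0]; group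
        rw [this, hval, if_neg hcond] at hval'
        exact absurd hval' zero_ne_one
      · rw [if_neg hg0]
  have hsum := sum_sign_mul_tokenSum hk c
  simp_rw [hf, mul_ite, mul_one, mul_zero, Finset.sum_ite_eq', Finset.mem_univ, if_true] at hsum
  have hunit : ((Equiv.Perm.sign (x₀⁻¹ * z₀) : ℤ) : ℂ) ≠ 0 := by
    rcases Int.units_eq_one_or (Equiv.Perm.sign (x₀⁻¹ * z₀)) with h1 | h1 <;> simp [h1]
  exact hunit hsum

/-- TPP-injectivity of `(x, y) ↦ x⁻¹ y` on `X × Y` (from separation, `Z ≠ ∅`). -/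
theorem quotXY_injOn {n k : ℕ} {X Y Z : Finset (Equiv.Perm (Fin n))} (h : ∀ x₀ ∈ X, ∀ z₀ ∈ Z, ∃ c : (Fin k → Fin n) → (Fin k → Fin n) → ℂ, ∀ x ∈ X, ∀ y ∈ Y,
      ∀ y' ∈ Y, ∀ z ∈ Z, (∑ p : Fin k → Fin n, c p (⇑(x⁻¹ * y * y'⁻¹ * z) ∘ p)) =
        if x = x₀ ∧ y = y' ∧ z = z₀ then 1 else 0)
    (hZ : Z.Nonempty) :
    Set.InjOn (fun q : Equiv.Perm (Fin n) × Equiv.Perm (Fin n) => q.1⁻¹ * q.2)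
      ((X ×ˢ Y : Finset _) : Set (Equiv.Perm (Fin n) × Equiv.Perm (Fin n))) := by
  classical
  obtain ⟨z₀, hz₀⟩ := hZ
  rintro ⟨x, y⟩ hxy ⟨x₁, y₁⟩ hxy₁ heq
  simp only [Finset.coe_product, Set.mem_prod, Finset.mem_coe] at hxy hxy₁
  simp only at heq
  obtain ⟨c, hc⟩ := h x hxy.1 z₀ hz₀
  have h1 := hc x₁ hxy₁.1 y₁ hxy₁.2 y hxy.2 z₀ hz₀
  have h0 := hc x hxy.1 y hxy.2 y hxy.2 z₀ hz₀
  rw [if_pos ⟨rfl, rfl, rfl⟩] at h0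
  have : x₁⁻¹ * y₁ * y⁻¹ * z₀ = x⁻¹ * y * y⁻¹ * z₀ := by rw [← heq]
  rw [this, h0] at h1
  by_cases hcond : x₁ = x ∧ y₁ = y ∧ z₀ = z₀
  · exact Prod.ext hcond.1.symm hcond.2.1.symm
  · rw [if_neg hcond] at h1; exact absurd h1 one_ne_zero

/-- TPP-injectivity of `(y', z) ↦ y'⁻¹ z` on `Y × Z` (from separation, `X ≠ ∅`). -/
theorem quotYZ_injOn {n k : ℕ} {X Y Z : Finset (Equiv.Perm (Fin n))} (h : ∀ x₀ ∈ X, ∀ z₀ ∈ Z, ∃ c : (Fin k → Fin n) → (Fin k → Fin n) → ℂ, ∀ x ∈ X, ∀ y ∈ Y,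
      ∀ y' ∈ Y, ∀ z ∈ Z, (∑ p : Fin k → Fin n, c p (⇑(x⁻¹ * y * y'⁻¹ * z) ∘ p)) =
        if x = x₀ ∧ y = y' ∧ z = z₀ then 1 else 0)
    (hX : X.Nonempty) :
    Set.InjOn (fun q : Equiv.Perm (Fin n) × Equiv.Perm (Fin n) => q.1⁻¹ * q.2)
      ((Y ×ˢ Z : Finset _) : Set (Equiv.Perm (Fin n) × Equiv.Perm (Fin n))) := by
  classical
  obtain ⟨x₀, hx₀⟩ := hX
  rintro ⟨y', z⟩ hyz ⟨y₁, z₁⟩ hyz₁ heq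
  simp only [Finset.coe_product, Set.mem_prod, Finset.mem_coe] at hyz hyz₁
  simp only at heq
  obtain ⟨c, hc⟩ := h x₀ hx₀ z hyz.2
  have h0 := hc x₀ hx₀ y' hyz.1 y' hyz.1 z hyz.2
  rw [if_pos ⟨rfl, rfl, rfl⟩] at h0
  have h1 := hc x₀ hx₀ y' hyz.1 y₁ hyz₁.1 z₁ hyz₁.2
  have : x₀⁻¹ * y' * y₁⁻¹ * z₁ = x₀⁻¹ * y' * y'⁻¹ * z := by
    rw [mul_assoc, mul_assoc, ← heq]; group
  rw [this, h0] at h1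
  by_cases hcond : x₀ = x₀ ∧ y' = y₁ ∧ z₁ = z
  · exact Prod.ext hcond.2.1 hcond.2.2.symm
  · rw [if_neg hcond] at h1; exact absurd h1 one_ne_zero

/-- **Covering wall.** For a `k`-token separated triple with `k + 2 ≤ n` and `X, Z ≠ ∅`:
`|X|·|Y| + |Y|·|Z| ≤ n!`. -/
theorem card_add_card_le_factorial {n k : ℕ} {X Y Z : Finset (Equiv.Perm (Fin n))}
    (h : ∀ x₀ ∈ X, ∀ z₀ ∈ Z, ∃ c : (Fin k → Fin n) → (Fin k → Fin n) → ℂ, ∀ x ∈ X, ∀ y ∈ Y,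
      ∀ y' ∈ Y, ∀ z ∈ Z, (∑ p : Fin k → Fin n, c p (⇑(x⁻¹ * y * y'⁻¹ * z) ∘ p)) =
        if x = x₀ ∧ y = y' ∧ z = z₀ then 1 else 0) (hk : k + 2 ≤ n) (hX : X.Nonempty) (hZ : Z.Nonempty) :
    X.card * Y.card + Y.card * Z.card ≤ n.factorial := by
  classical
  obtain ⟨x₀, hx₀⟩ := hX
  obtain ⟨z₀, hz₀⟩ := id hZ
  obtain ⟨g, hg⟩ := exists_not_mem_quot h hk hx₀ hz₀
  let qf : Equiv.Perm (Fin n) × Equiv.Perm (Fin n) → Equiv.Perm (Fin n) := fun q => q.1⁻¹ * q.2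
  set A := (X ×ˢ Y).image qf with hA
  set B := (Y ×ˢ Z).image qf with hB
  have hAc : A.card = X.card * Y.card := by
    rw [hA, Finset.card_image_of_injOn (quotXY_injOn h hZ), Finset.card_product]
  have hBc : B.card = Y.card * Z.card := by
    rw [hB, Finset.card_image_of_injOn (quotYZ_injOn h ⟨x₀, hx₀⟩), Finset.card_product]
  set A' := A.image (fun a => a⁻¹ * g) with hA'
  have hA'c : A'.card = A.card := by
    rw [hA']
    exact Finset.card_image_of_injective _ (fun a₁ a₂ h12 => by simpa using h12)
  have hdisj : Disjoint A' B := by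
    rw [Finset.disjoint_left]
    intro w hwA hwB
    rw [hA', Finset.mem_image] at hwA
    obtain ⟨a, haA, rfl⟩ := hwA
    rw [hA, Finset.mem_image] at haA
    obtain ⟨⟨x, y⟩, hxy, rfl⟩ := haA
    rw [hB, Finset.mem_image] at hwB
    obtain ⟨⟨y', z⟩, hyz, hw⟩ := hwB
    simp only [Finset.mem_product] at hxy hyz
    apply hg x hxy.1 y hxy.2 y' hyz.1 z hyz.2
    simp only [qf] at hw
    calc x⁻¹ * y * y'⁻¹ * z = (x⁻¹ * y) * (y'⁻¹ * z) := by group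
      _ = (x⁻¹ * y) * ((x⁻¹ * y)⁻¹ * g) := by rw [hw]
      _ = g := by group
  have hle : (A' ∪ B).card ≤ (Finset.univ : Finset (Equiv.Perm (Fin n))).card :=
    Finset.card_le_card (Finset.subset_univ _)
  rw [Finset.card_union_of_disjoint hdisj, Finset.card_univ, Fintype.card_perm, Fintype.card_fin,
    hA'c, hAc, hBc] at hle
  exact hle


/-- `(x, z) ↦ x⁻¹ z` is injective on `X × Z` (from separation, `Y ≠ ∅`). -/
theorem quotXZ_injOn {n k : ℕ} {X Y Z : Finset (Equiv.Perm (Fin n))} (h : ∀ x₀ ∈ X, ∀ z₀ ∈ Z, ∃ c : (Fin k → Fin n) → (Fin k → Fin n) → ℂ, ∀ x ∈ X, ∀ y ∈ Y,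
      ∀ y' ∈ Y, ∀ z ∈ Z, (∑ p : Fin k → Fin n, c p (⇑(x⁻¹ * y * y'⁻¹ * z) ∘ p)) =
        if x = x₀ ∧ y = y' ∧ z = z₀ then 1 else 0)
    (hY : Y.Nonempty) :
    Set.InjOn (fun q : Equiv.Perm (Fin n) × Equiv.Perm (Fin n) => q.1⁻¹ * q.2)
      ((X ×ˢ Z : Finset _) : Set (Equiv.Perm (Fin n) × Equiv.Perm (Fin n))) := by
  classical
  obtain ⟨y₀, hy₀⟩ := hY
  rintro ⟨x, z⟩ hxz ⟨x₁, z₁⟩ hxz₁ heq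
  simp only [Finset.coe_product, Set.mem_prod, Finset.mem_coe] at hxz hxz₁
  simp only at heq
  obtain ⟨c, hc⟩ := h x hxz.1 z hxz.2
  have h0 := hc x hxz.1 y₀ hy₀ y₀ hy₀ z hxz.2
  rw [if_pos ⟨rfl, rfl, rfl⟩] at h0
  have h1 := hc x₁ hxz₁.1 y₀ hy₀ y₀ hy₀ z₁ hxz₁.2
  have : x₁⁻¹ * y₀ * y₀⁻¹ * z₁ = x⁻¹ * y₀ * y₀⁻¹ * z := by
    have e1 : x₁⁻¹ * y₀ * y₀⁻¹ * z₁ = x₁⁻¹ * z₁ := by group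
    have e2 : x⁻¹ * y₀ * y₀⁻¹ * z = x⁻¹ * z := by group
    rw [e1, e2]; exact heq.symm
  rw [this, h0] at h1
  by_cases hcond : x₁ = x ∧ y₀ = y₀ ∧ z₁ = z
  · exact Prod.ext hcond.1.symm hcond.2.2.symm
  · rw [if_neg hcond] at h1; exact absurd h1 one_ne_zero

/-- **Half the packing bound.** For a `k`-token separated triple with `k + 2 ≤ n`:
`4 (|X||Y||Z|)² ≤ (n!)³`, i.e. `|X||Y||Z| ≤ (n!)^{3/2} / 2` (covering wall `ab + bc ≤ n!` and
`ac ≤ n!`; AM–GM).  The classical TPP packing bound is `(n!)^{3/2}`. -/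
theorem four_mul_volume_sq_le {n k : ℕ} {X Y Z : Finset (Equiv.Perm (Fin n))}
    (h : ∀ x₀ ∈ X, ∀ z₀ ∈ Z, ∃ c : (Fin k → Fin n) → (Fin k → Fin n) → ℂ, ∀ x ∈ X, ∀ y ∈ Y,
      ∀ y' ∈ Y, ∀ z ∈ Z, (∑ p : Fin k → Fin n, c p (⇑(x⁻¹ * y * y'⁻¹ * z) ∘ p)) =
        if x = x₀ ∧ y = y' ∧ z = z₀ then 1 else 0) (hk : k + 2 ≤ n) :
    4 * (X.card * Y.card * Z.card) ^ 2 ≤ n.factorial ^ 3 := by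
  classical
  rcases X.eq_empty_or_nonempty with hX | hX
  · simp [hX]
  rcases Y.eq_empty_or_nonempty with hY | hY
  · simp [hY]
  rcases Z.eq_empty_or_nonempty with hZ | hZ
  · simp [hZ]
  have h1 := card_add_card_le_factorial h hk hX hZ
  have h2 : X.card * Z.card ≤ n.factorial := by
    have := Finset.card_le_univ ((X ×ˢ Z).image
      (fun q : Equiv.Perm (Fin n) × Equiv.Perm (Fin n) => q.1⁻¹ * q.2))
    rwa [Finset.card_image_of_injOn (quotXZ_injOn h hY), Finset.card_product,
      Fintype.card_perm, Fintype.card_fin] at this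
  set a := X.card; set b := Y.card; set c := Z.card
  -- 4(ab)(bc) ≤ (ab+bc)² ≤ (n!)², and ac ≤ n!
  have h3 : 4 * (a * b) * (b * c) ≤ n.factorial ^ 2 := by
    calc 4 * (a * b) * (b * c) ≤ (a * b + b * c) ^ 2 := by nlinarith [sq_nonneg (a*b - b*c : ℤ), sq_abs (a*b - b*c : ℤ)]
      _ ≤ n.factorial ^ 2 := Nat.pow_le_pow_left h1 2
  calc 4 * (a * b * c) ^ 2 = (4 * (a * b) * (b * c)) * (a * c) := by ring
    _ ≤ n.factorial ^ 2 * n.factorial := Nat.mul_le_mul h3 h2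
    _ = n.factorial ^ 3 := by ring


end

end Summit.MatrixMultiplication.MatrixMultiplication.Theorems.SnLevelDesigns.Negative
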